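import Mathlib
import Summits.ValiantsHypothesis.ValiantsHypothesis.Theorems.BarrierLeverPartitionMinorsHitByVPHiddenStatesLowerToAll
import Summits.ValiantsHypothesis.ValiantsHypothesis.Theorems.BarrierLeverPartitionMinorsHitByVPHiddenStatesGradedColexHalfCube

/-!
# Route BarrierLever — item `PartitionMinorsHitByVP` (stmt-ValiantsHypothesis-19717), line `hidden_states`:
# the exact-half graded-colex design serves every TRANSVERSAL family, for every `h`

Helper file (`--supports stmt-ValiantsHypothesis-19717`; cell valiant-natproofs, rung V4, 𝒟-side door (c), registered line
`Cruxes/PartitionMinorsHitByVP/Lines/hidden_states.lean` v8; prover seat val-np-p6 gen 15). Definition-free; closes NO item.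

An UNCONDITIONAL infinite class of NON-lower row families at the exact half, for every `h ≥ 1`: call an injective family
`u : Fin (2^{h−1}) → Finset (Fin h)` TRANSVERSAL in the coordinate `x` if no member containing `x` has its shadow `u i ∖ x` in the
family (`∀ i k, x ∈ u i → u k ≠ (u i).erase x`; e.g. every family of odd-cardinality sets, every family of even-cardinality sets, the
star `{S ∋ x}`, and all `2^{2^{h−1}}` sections `{S' ∪ ε(S')·{x} : S' ⊆ [h] ∖ x}` of the projection along `x`). Then the one-piece
graded-colex family of size `2^{h−1}` on `K = h` states (the GC½ design; ANY `cols` satisfying the graded-colex threshold, as in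
p636831/p645664) has a table making the block-additive matrix of `u` nonsingular (`gc_half_serves_transversal`).

PROOF. The down-compression `𝓓_x u` is `i ↦ u i ∖ x` (every member containing `x` moves), an injective family avoiding `x`, which the
design serves by val-np-p6 g14's subcube theorem `BallDiag.gc_hypothesis_half_subcube` (p645664, antipodal table); one translation
step `LowerToAll.step` (p654929: shift the base coordinate `x`) pulls the table back to `u`.

WHAT THIS IS NOT: nothing for families that are not transversal in some coordinate (e.g. most down-sets: GC½ itself stays open);
nothing below or above the exact half; nothing on crux 14610 or VP ≠ VNP.
-/

set_option linter.dupNamespace false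

namespace Summit.ValiantsHypothesis.ValiantsHypothesis.Theorems.BarrierLever.HiddenStates

open Finset

namespace LowerToAll

/-- **The exact-half GC design serves every transversal family.** See the module docstring. -/
theorem gc_half_serves_transversal (h : ℕ) (h1 : 1 ≤ h) (cols : Fin (2 ^ (h - 1)) → Finset (Fin h))
    (hinj : Function.Injective cols)
    (hgc : ∀ k J, J ∉ Set.range cols → ∑ q ∈ cols k, (2 ^ h + 2 ^ (q : ℕ)) < ∑ q ∈ J, (2 ^ h + 2 ^ (q : ℕ)))
    (x : Fin h) (u : Fin (2 ^ (h - 1)) → Finset (Fin h)) (hu : Function.Injective u)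
    (htr : ∀ i k, x ∈ u i → u k ≠ (u i).erase x) :
    ∃ tx : Option (Fin h) → Fin h → ℂ,
      (Matrix.of fun i k : Fin (2 ^ (h - 1)) => ∏ a ∈ u i, (tx none a + ∑ q ∈ cols k, tx (some q) a)).det ≠ 0 := by
  classical
  -- the compression `𝓓_x u`: every member loses `x`
  let v : Fin (2 ^ (h - 1)) → Finset (Fin h) := fun i => (u i).erase x
  have hv₁ : ∀ i, x ∈ u i → (∀ k, u k ≠ (u i).erase x) → v i = (u i).erase x := fun _ _ _ => rfl
  have hv₂ : ∀ i, ¬ (x ∈ u i ∧ ∀ k, u k ≠ (u i).erase x) → v i = u i := by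
    intro i hi
    by_cases hx : x ∈ u i
    · exact absurd ⟨hx, fun k => htr i k hx⟩ hi
    · exact Finset.erase_eq_of_notMem hx
  have hv_inj : Function.Injective v := DownCompression.injective_of_compOf u v x hu hv₁ hv₂
  have hvx : ∀ i, x ∉ v i := fun i => Finset.notMem_erase x (u i)
  obtain ⟨tx₀, h₀⟩ := BallDiag.gc_hypothesis_half_subcube h h1 cols hinj hgc x v hv_inj hvx
  -- one translation step in the coordinate `x`
  have hdet : (Matrix.of fun i k : Fin (2 ^ (h - 1)) =>
      ∏ c ∈ v i, ((fun _ : Fin 1 => tx₀) ((fun k => ((0 : Fin 1), cols k)) k).1 none c +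
        ∑ q ∈ ((fun k => ((0 : Fin 1), cols k)) k).2,
          (fun _ : Fin 1 => tx₀) ((fun k => ((0 : Fin 1), cols k)) k).1 (some q) c)).det ≠ 0 := h₀
  obtain ⟨t, ht⟩ := step (fun k => ((0 : Fin 1), cols k)) u v x hv₁ hv₂ (fun _ => tx₀) hdet
  refine ⟨fun o c => match o with
    | none => tx₀ none c + (if c = x then t else 0)
    | some q => tx₀ (some q) c, ?_⟩
  exact ht

/-- Example: every injective family of ODD-cardinality sets is transversal in every coordinate, hence served at the exact half. -/
theorem gc_half_serves_odd (h : ℕ) (h1 : 1 ≤ h) (cols : Fin (2 ^ (h - 1)) → Finset (Fin h))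
    (hinj : Function.Injective cols)
    (hgc : ∀ k J, J ∉ Set.range cols → ∑ q ∈ cols k, (2 ^ h + 2 ^ (q : ℕ)) < ∑ q ∈ J, (2 ^ h + 2 ^ (q : ℕ)))
    (u : Fin (2 ^ (h - 1)) → Finset (Fin h)) (hu : Function.Injective u) (hodd : ∀ i, Odd (u i).card) :
    ∃ tx : Option (Fin h) → Fin h → ℂ,
      (Matrix.of fun i k : Fin (2 ^ (h - 1)) => ∏ a ∈ u i, (tx none a + ∑ q ∈ cols k, tx (some q) a)).det ≠ 0 := by
  have hx : 0 < h := h1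
  refine gc_half_serves_transversal h h1 cols hinj hgc ⟨0, hx⟩ u hu fun i k hxi hk => ?_
  have h1' := hodd k
  rw [hk, Finset.card_erase_of_mem hxi] at h1'
  have h2 := hodd i
  obtain ⟨m, hm⟩ := h2
  rw [hm, Nat.add_sub_cancel] at h1'
  exact (Nat.not_even_iff_odd.mpr h1') (even_two_mul m)

end LowerToAll

end Summit.ValiantsHypothesis.ValiantsHypothesis.Theorems.BarrierLever.HiddenStates
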